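import Summits.HodgeConjecture.HodgeConjecture.Theorems.F0P3cStCharTSOffStratumG        -- ★ (LH6-p04 (g2)): `valuation_eq_one_of_map_mul_self`, `map_mul_self_eq_one_of_scalar_mem`
import Literature.NumberTheory.Automorphic.CMLocalNonsplitBorelTransport                 -- ★ R5b-cm (B-p04): `mem_range_glDiagonal_iff_isDiag`, `apply_eq_zero_iff_apply_apply_eq_zero` (N-free), the N = 3 originals
import Literature.NumberTheory.Automorphic.LocalUnitaryGroupCenter                       -- ★ `localNonsplitEquiv_mem_center`, `exists_coe_eq_scalar_of_mem_center_unitaryGroupOfForm`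
import Literature.NumberTheory.Automorphic.UnitaryGroupInertPlaceHyperbolicBasis         -- ★ `galAdicCompletionMap_galAdicCompletionMap_of_smul_eq`
import HarnessLib

/-!
# `F0P3cCMLocalNonsplitBorelTransportU2` — road (D) «DEEP-FL», block (U2-B) part 1: the one-place model `U(Φ₂)(L⁺_v) ≃ₜ* U(σ_w, Φ₂)(L_w)` at a non-split place
# respects the Borel pair of `H₂ = U(Φ₂)` — torus ↔ torus, radical ↔ radical, centre ↔ centre; central elements of the model are integral; ratio data of the ray `d(α, (σ_w α)⁻¹)`

Cell `pub/hodgecm-mathlib`, crux H413 = `stmt-HodgeConjecture-24833` (lane `--supports … --as helper`), route HCCMUnconditional; seat LH4-p02 (g3) on the road (D)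
owner LH6-p04 (g3)'s deal «IWAHORI-U2★» block (U2-B).  THEOREMS ONLY: no `def`, no instance, no notation, no `sorry`, no named fact.  The `N = 2` mirror of ★
`Literature/NumberTheory/Automorphic/CMLocalNonsplitBorelTransport` (B-p04, `N = 3`, `Φ₃ = qsForm`) and of §1 of ★ `Theorems/F0P3CMBorelIwahoriDatum`, proofs verbatim with
`3 ↦ 2`; consumed by part 2 ★∕GREEN `Theorems/F0P3cCMBorelIwahoriDatumU2` (the transport of an Iwahori datum to `cmBorelTriple L 2 v`).
HONEST LABEL: HC_CM is proved only modulo the 7 printed citations (2 remaining: hLiu418 = stmt-HodgeConjecture-24832, h413 = stmt-HodgeConjecture-24833) until rung 0 closes;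
count-neutral plumbing.

THE MATHEMATICS ([PlatonovRapinchuk1994, §5.1]: for `v` non-split, `G_{F_v} = G(E_w)` — the one-place model; [Rogawski1990, §1.10 p. 9; §4.4 p. 46]: `B = T N` in `U(2)`).
`e := localNonsplitEquiv c Φ₂ _ w hw` reads a matrix over `∏_{w′ ∣ v} L_{w′}` at the UNIQUE place `w` above `v`; «diagonal» and «upper unitriangular» are entrywise
conditions, hence `T′.comap e = T₂`, `N′.comap e = N₂`; `e` is a group isomorphism, hence `Z′.comap e = Z`.  A central element of `U′ = U(σ_w, Φ₂)(L_w)` is a scalar `u·1`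
([PlatonovRapinchuk1994, §2.3], ★ `exists_coe_eq_scalar_of_mem_center_unitaryGroupOfForm`) with `σ_w(u) u = 1` (the `(0,1)` entry of `Φ₂`), so `|u|_w = 1` and `u·1 ∈ GL₂(𝒪_w)`.

* `placeForm_antidiagTwo_eq`, `localNonsplitEquiv_apply_apply₂`, `localNonsplitEquiv_mem_torusU_iff₂` ∕ **`comap_localNonsplitEquiv_torusU₂`**,
  `localNonsplitEquiv_mem_unipotentU_iff₂` ∕ **`comap_localNonsplitEquiv_unipotentU₂`**, `localNonsplitEquiv_mem_center_iff₂` ∕ **`comap_localNonsplitEquiv_center₂`**,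
  **`center_le_comap_glInt₂`**, **`exists_units_of_coe_eq_diagonal₂`**.

## References
* [PlatonovRapinchuk1994] V. Platonov, A. Rapinchuk, *Algebraic Groups and Number Theory* (1994), §2.3, §5.1 (the one-place model).
* [Rogawski1990] J. D. Rogawski, *Automorphic Representations of Unitary Groups in Three Variables* (1990), §1.10 p. 9; §4.4 p. 46 (`H = U(2) × U(1)`).
* [Casselman1995] W. Casselman, *Introduction to the theory of admissible representations of `p`-adic reductive groups* (draft 1 May 1995), Prop. 1.4.3, Prop. 1.4.4.
-/

set_option autoImplicit false
-- the mandated namespace has the single-problem summit's repeated segment (`HodgeConjecture.HodgeConjecture`)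
set_option linter.dupNamespace false

open scoped MatrixGroups Pointwise WithZero
open ValuativeRel Matrix
open Literature.NumberTheory Literature.NumberTheory.Automorphic Literature.NumberTheory.Automorphic.UnitaryGroup
open _root_.NumberField _root_.IsDedekindDomain

namespace Summit.HodgeConjecture.HodgeConjecture.Cruxes.H413.F0P3cCMLocalNonsplitBorelTransportU2

variable (L : Type) [Field L] [NumberField L] [IsCMField L] (v : HeightOneSpectrum (𝓞 ↥(maximalRealSubfield L)))
  (w : PlacesOver L v) (hw : IsCMField.complexConj L • w.1 = w.1)

/-! ## §1 Model lemmas at the place `w` for `U(Φ₂)` -/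

omit [IsCMField L] in
/-- The local form of `Φ₂` at `w` is `Φ₂` over `L_w` (★ `antidiagOne_eq_over`, `StdForm.over_map`). [cite: Rogawski1990, §1.10 p. 9; §4.4 p. 46] -/
theorem placeForm_antidiagTwo_eq :
    placeForm (Matrix.of fun i j : Fin 2 => if i.val + j.val + 1 = 2 then (1 : L) else 0) w.1 = (StdForm.antidiagonal 2).over (w.1.adicCompletion L) := by
  rw [placeForm, antidiagOne_eq_over, StdForm.over_map]

/-- Entry formula for the one-place model of `U(Φ₂)`: `(e g)ᵢⱼ = gᵢⱼ(w)` (★ `coe_localNonsplitEquiv_apply`). [cite: PlatonovRapinchuk1994, §5.1] -/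
theorem localNonsplitEquiv_apply_apply₂ (g : «local» L (IsCMField.complexConj L) 2 (Matrix.of fun i j : Fin 2 => if i.val + j.val + 1 = 2 then (1 : L) else 0) v)
    (i j : Fin 2) :
    (((localNonsplitEquiv (IsCMField.complexConj L) (Matrix.of fun i j : Fin 2 => if i.val + j.val + 1 = 2 then (1 : L) else 0)
          (IsCMField.complexConj_ne_one L) w hw g :
        ↥(unitaryGroupOfForm (galAdicCompletionMap (L := L) (IsCMField.complexConj L) hw)
          (placeForm (Matrix.of fun i j : Fin 2 => if i.val + j.val + 1 = 2 then (1 : L) else 0) w.1))) :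
          GL (Fin 2) (w.1.adicCompletion L)) : Matrix (Fin 2) (Fin 2) (w.1.adicCompletion L)) i j =
      (((g : «local» L (IsCMField.complexConj L) 2 (Matrix.of fun i j : Fin 2 => if i.val + j.val + 1 = 2 then (1 : L) else 0) v) :
          GL (Fin 2) (LocalRing L v)) : Matrix (Fin 2) (Fin 2) (LocalRing L v)) i j w := by
  have h := congr_fun (congr_fun (coe_localNonsplitEquiv_apply L (Matrix.of fun i j : Fin 2 => if i.val + j.val + 1 = 2 then (1 : L) else 0) v w hw g) i) j
  rw [h, Matrix.map_apply, Pi.evalRingHom_apply]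

/-- **Torus ↔ torus** at `N = 2`: `e g ∈ T(L_w) ↔ g ∈ T₂(L⁺_v) = (cmBorelTriple L 2 v).M` (both are «the matrix is diagonal», read entrywise at the unique place `w`).
[cite: PlatonovRapinchuk1994, §5.1] [cite: Rogawski1990, §1.10 p. 9] -/
theorem localNonsplitEquiv_mem_torusU_iff₂ (g : «local» L (IsCMField.complexConj L) 2 (Matrix.of fun i j : Fin 2 => if i.val + j.val + 1 = 2 then (1 : L) else 0) v) :
    localNonsplitEquiv (IsCMField.complexConj L) (Matrix.of fun i j : Fin 2 => if i.val + j.val + 1 = 2 then (1 : L) else 0) (IsCMField.complexConj_ne_one L) w hw g ∈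
        torusU (galAdicCompletionMap (L := L) (IsCMField.complexConj L) hw)
          (placeForm (Matrix.of fun i j : Fin 2 => if i.val + j.val + 1 = 2 then (1 : L) else 0) w.1) ↔
      g ∈ (cmBorelTriple L 2 v).M := by
  have hL : localNonsplitEquiv (IsCMField.complexConj L) (Matrix.of fun i j : Fin 2 => if i.val + j.val + 1 = 2 then (1 : L) else 0)
        (IsCMField.complexConj_ne_one L) w hw g ∈
        torusU (galAdicCompletionMap (L := L) (IsCMField.complexConj L) hw)
          (placeForm (Matrix.of fun i j : Fin 2 => if i.val + j.val + 1 = 2 then (1 : L) else 0) w.1) ↔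
      (((localNonsplitEquiv (IsCMField.complexConj L) (Matrix.of fun i j : Fin 2 => if i.val + j.val + 1 = 2 then (1 : L) else 0)
          (IsCMField.complexConj_ne_one L) w hw g :
        ↥(unitaryGroupOfForm (galAdicCompletionMap (L := L) (IsCMField.complexConj L) hw)
          (placeForm (Matrix.of fun i j : Fin 2 => if i.val + j.val + 1 = 2 then (1 : L) else 0) w.1))) :
          GL (Fin 2) (w.1.adicCompletion L)) : Matrix (Fin 2) (Fin 2) (w.1.adicCompletion L)).IsDiag :=
    (mem_torusU_iff _).trans (MonoidHom.mem_range.symm.trans (mem_range_glDiagonal_iff_isDiag _))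
  have hR : g ∈ (cmBorelTriple L 2 v).M ↔
      (((g : «local» L (IsCMField.complexConj L) 2 (Matrix.of fun i j : Fin 2 => if i.val + j.val + 1 = 2 then (1 : L) else 0) v) :
          GL (Fin 2) (LocalRing L v)) : Matrix (Fin 2) (Fin 2) (LocalRing L v)).IsDiag :=
    (mem_torusU_iff (σ := conjLocal L (IsCMField.complexConj L) v) (J := cmLocalForm L 2 v) g).trans
      (MonoidHom.mem_range.symm.trans (mem_range_glDiagonal_iff_isDiag _))
  rw [hL, hR]
  simp only [Matrix.IsDiag, Pairwise]
  refine forall_congr' fun i => forall_congr' fun j => imp_congr_right fun _ => ?_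
  rw [localNonsplitEquiv_apply_apply₂, ← apply_eq_zero_iff_apply_apply_eq_zero L v w hw]

/-- **`T(L_w).comap e = (cmBorelTriple L 2 v).M`**. [cite: PlatonovRapinchuk1994, §5.1] [cite: Rogawski1990, §1.10 p. 9] -/
theorem comap_localNonsplitEquiv_torusU₂ :
    (torusU (galAdicCompletionMap (L := L) (IsCMField.complexConj L) hw)
        (placeForm (Matrix.of fun i j : Fin 2 => if i.val + j.val + 1 = 2 then (1 : L) else 0) w.1)).comap
        (localNonsplitEquiv (IsCMField.complexConj L) (Matrix.of fun i j : Fin 2 => if i.val + j.val + 1 = 2 then (1 : L) else 0)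
            (IsCMField.complexConj_ne_one L) w hw :
          «local» L (IsCMField.complexConj L) 2 (Matrix.of fun i j : Fin 2 => if i.val + j.val + 1 = 2 then (1 : L) else 0) v →*
            ↥(unitaryGroupOfForm (galAdicCompletionMap (L := L) (IsCMField.complexConj L) hw)
              (placeForm (Matrix.of fun i j : Fin 2 => if i.val + j.val + 1 = 2 then (1 : L) else 0) w.1))) =
      (cmBorelTriple L 2 v).M := by
  ext g
  rw [Subgroup.mem_comap]
  exact localNonsplitEquiv_mem_torusU_iff₂ L v w hw g

/-- **Radical ↔ radical** at `N = 2`: `e g ∈ N(L_w) ↔ g ∈ N₂(L⁺_v) = (cmBorelTriple L 2 v).N` (upper unitriangular on both sides, read entrywise at the unique place `w`).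
[cite: PlatonovRapinchuk1994, §5.1] [cite: Rogawski1990, §1.10 p. 9] -/
theorem localNonsplitEquiv_mem_unipotentU_iff₂ (g : «local» L (IsCMField.complexConj L) 2 (Matrix.of fun i j : Fin 2 => if i.val + j.val + 1 = 2 then (1 : L) else 0) v) :
    localNonsplitEquiv (IsCMField.complexConj L) (Matrix.of fun i j : Fin 2 => if i.val + j.val + 1 = 2 then (1 : L) else 0) (IsCMField.complexConj_ne_one L) w hw g ∈
        unipotentU (galAdicCompletionMap (L := L) (IsCMField.complexConj L) hw)
          (placeForm (Matrix.of fun i j : Fin 2 => if i.val + j.val + 1 = 2 then (1 : L) else 0) w.1) ↔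
      g ∈ (cmBorelTriple L 2 v).N := by
  haveI : Subsingleton (PlacesOver L v) :=
    PlacesOver.subsingleton_of_smul_eq (IsCMField.complexConj L) (IsCMField.complexConj_ne_one L) w hw
  have key := localNonsplitEquiv_apply_apply₂ L v w hw g
  rw [mem_unipotentU_iff]
  change _ ↔ ((g : «local» L (IsCMField.complexConj L) 2 (Matrix.of fun i j : Fin 2 => if i.val + j.val + 1 = 2 then (1 : L) else 0) v) :
      GL (Fin 2) (LocalRing L v)) ∈ upperUnitriangular (Fin 2) (LocalRing L v)
  rw [mem_upperUnitriangular_iff]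
  constructor
  · rintro ⟨htri, hdiag⟩
    refine ⟨fun i j hij => ?_, fun i => ?_⟩
    · funext w'
      obtain rfl : w' = w := Subsingleton.elim _ _
      rw [← key, htri hij]
      rfl
    · funext w'
      obtain rfl : w' = w := Subsingleton.elim _ _
      rw [← key, hdiag i]
      rfl
  · rintro ⟨htri, hdiag⟩
    refine ⟨fun i j hij => ?_, fun i => ?_⟩
    · rw [key, htri hij]
      rfl
    · rw [key, hdiag i]
      rfl

/-- **`N(L_w).comap e = (cmBorelTriple L 2 v).N`**. [cite: PlatonovRapinchuk1994, §5.1] [cite: Rogawski1990, §1.10 p. 9] -/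
theorem comap_localNonsplitEquiv_unipotentU₂ :
    (unipotentU (galAdicCompletionMap (L := L) (IsCMField.complexConj L) hw)
        (placeForm (Matrix.of fun i j : Fin 2 => if i.val + j.val + 1 = 2 then (1 : L) else 0) w.1)).comap
        (localNonsplitEquiv (IsCMField.complexConj L) (Matrix.of fun i j : Fin 2 => if i.val + j.val + 1 = 2 then (1 : L) else 0)
            (IsCMField.complexConj_ne_one L) w hw :
          «local» L (IsCMField.complexConj L) 2 (Matrix.of fun i j : Fin 2 => if i.val + j.val + 1 = 2 then (1 : L) else 0) v →*
            ↥(unitaryGroupOfForm (galAdicCompletionMap (L := L) (IsCMField.complexConj L) hw)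
              (placeForm (Matrix.of fun i j : Fin 2 => if i.val + j.val + 1 = 2 then (1 : L) else 0) w.1))) =
      (cmBorelTriple L 2 v).N := by
  ext g
  rw [Subgroup.mem_comap]
  exact localNonsplitEquiv_mem_unipotentU_iff₂ L v w hw g

/-- **Centre ↔ centre** at `N = 2`: `e z ∈ Z(U(σ_w,Φ₂)(L_w)) ↔ z ∈ Z(U(Φ₂)(L⁺_v))` (★ `localNonsplitEquiv_mem_center`; `e` injective).
[cite: PlatonovRapinchuk1994, §5.1] -/
theorem localNonsplitEquiv_mem_center_iff₂ (z : «local» L (IsCMField.complexConj L) 2 (Matrix.of fun i j : Fin 2 => if i.val + j.val + 1 = 2 then (1 : L) else 0) v) :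
    localNonsplitEquiv (IsCMField.complexConj L) (Matrix.of fun i j : Fin 2 => if i.val + j.val + 1 = 2 then (1 : L) else 0) (IsCMField.complexConj_ne_one L) w hw z ∈
        Subgroup.center ↥(unitaryGroupOfForm (galAdicCompletionMap (L := L) (IsCMField.complexConj L) hw)
          (placeForm (Matrix.of fun i j : Fin 2 => if i.val + j.val + 1 = 2 then (1 : L) else 0) w.1)) ↔
      z ∈ Subgroup.center («local» L (IsCMField.complexConj L) 2 (Matrix.of fun i j : Fin 2 => if i.val + j.val + 1 = 2 then (1 : L) else 0) v) := by
  refine ⟨fun hz => ?_, fun hz => localNonsplitEquiv_mem_center (IsCMField.complexConj L)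
    (Matrix.of fun i j : Fin 2 => if i.val + j.val + 1 = 2 then (1 : L) else 0) v (IsCMField.complexConj_ne_one L) w hw hz⟩
  rw [Subgroup.mem_center_iff] at hz ⊢
  intro g
  apply (localNonsplitEquiv (IsCMField.complexConj L) (Matrix.of fun i j : Fin 2 => if i.val + j.val + 1 = 2 then (1 : L) else 0)
    (IsCMField.complexConj_ne_one L) w hw).injective
  rw [map_mul, map_mul]
  exact hz _

/-- **`Z(U(σ_w,Φ₂)(L_w)).comap e = Z(U(Φ₂)(L⁺_v))`**. [cite: PlatonovRapinchuk1994, §5.1] -/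
theorem comap_localNonsplitEquiv_center₂ :
    (Subgroup.center ↥(unitaryGroupOfForm (galAdicCompletionMap (L := L) (IsCMField.complexConj L) hw)
        (placeForm (Matrix.of fun i j : Fin 2 => if i.val + j.val + 1 = 2 then (1 : L) else 0) w.1))).comap
        (localNonsplitEquiv (IsCMField.complexConj L) (Matrix.of fun i j : Fin 2 => if i.val + j.val + 1 = 2 then (1 : L) else 0)
            (IsCMField.complexConj_ne_one L) w hw :
          «local» L (IsCMField.complexConj L) 2 (Matrix.of fun i j : Fin 2 => if i.val + j.val + 1 = 2 then (1 : L) else 0) v →*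
            ↥(unitaryGroupOfForm (galAdicCompletionMap (L := L) (IsCMField.complexConj L) hw)
              (placeForm (Matrix.of fun i j : Fin 2 => if i.val + j.val + 1 = 2 then (1 : L) else 0) w.1))) =
      Subgroup.center («local» L (IsCMField.complexConj L) 2 (Matrix.of fun i j : Fin 2 => if i.val + j.val + 1 = 2 then (1 : L) else 0) v) := by
  ext z
  rw [Subgroup.mem_comap]
  exact localNonsplitEquiv_mem_center_iff₂ L v w hw z

/-- **Central elements of the model `U(σ_w, Φ₂)(L_w)` are integral**: `Z(U′) ≤ U′ ∩ GL₂(𝒪_w)` (central ⇒ scalar `u·1`, ★ `exists_coe_eq_scalar_of_mem_center_unitaryGroupOfForm`;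
the unitary relation at the `(0,1)` entry of `Φ₂` gives `σ_w(u) u = 1` (★ `map_mul_self_eq_one_of_scalar_mem`), so `|u|_w = 1` (★ `valuation_eq_one_of_map_mul_self`)).
[cite: PlatonovRapinchuk1994, §2.3; §5.1] -/
theorem center_le_comap_glInt₂ :
    Subgroup.center ↥(unitaryGroupOfForm (galAdicCompletionMap (L := L) (IsCMField.complexConj L) hw)
        (placeForm (Matrix.of fun i j : Fin 2 => if i.val + j.val + 1 = 2 then (1 : L) else 0) w.1)) ≤
      (glInt 2 (w.1.adicCompletion L)).comap
        (unitaryGroupOfForm (galAdicCompletionMap (L := L) (IsCMField.complexConj L) hw)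
          (placeForm (Matrix.of fun i j : Fin 2 => if i.val + j.val + 1 = 2 then (1 : L) else 0) w.1)).subtype := by
  intro z hz
  haveI : CharZero (w.1.adicCompletion L) := charZero_of_injective_algebraMap (algebraMap L (w.1.adicCompletion L)).injective
  have hJw := placeForm_antidiagTwo_eq L v w
  have hσσ : ∀ x, galAdicCompletionMap (L := L) (IsCMField.complexConj L) hw (galAdicCompletionMap (L := L) (IsCMField.complexConj L) hw x) = x :=
    galAdicCompletionMap_galAdicCompletionMap_of_smul_eq (IsCMField.complexConj L) w (IsCMField.complexConj_ne_one L) hw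
  have hσv : ∀ x, Valued.v ((galAdicCompletionMap (L := L) (IsCMField.complexConj L) hw) x) = Valued.v x :=
    fun x => valued_galAdicCompletionMap (L := L) (IsCMField.complexConj L) hw x
  have hH : ((placeForm (Matrix.of fun i j : Fin 2 => if i.val + j.val + 1 = 2 then (1 : L) else 0) w.1).map
        (galAdicCompletionMap (L := L) (IsCMField.complexConj L) hw))ᵀ =
      placeForm (Matrix.of fun i j : Fin 2 => if i.val + j.val + 1 = 2 then (1 : L) else 0) w.1 := by rw [hJw, StdForm.over_map, StdForm.transpose_over]
  have hHd : (placeForm (Matrix.of fun i j : Fin 2 => if i.val + j.val + 1 = 2 then (1 : L) else 0) w.1).det ≠ 0 := by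
    rw [hJw]; exact ((Matrix.isUnit_iff_isUnit_det _).1 ((StdForm.antidiagonal 2).isUnit_over _)).ne_zero
  have h01 : placeForm (Matrix.of fun i j : Fin 2 => if i.val + j.val + 1 = 2 then (1 : L) else 0) w.1 0 1 ≠ 0 := by
    simp only [placeForm, Matrix.map_apply, Matrix.of_apply]
    simp
  obtain ⟨u, hu⟩ := UnitaryGroup.exists_coe_eq_scalar_of_mem_center_unitaryGroupOfForm
    (galAdicCompletionMap (L := L) (IsCMField.complexConj L) hw) _ hσσ hH hHd (by norm_num) (by norm_num) hz
  have hmat : (((z : ↥(unitaryGroupOfForm _ _)) : GL (Fin 2) (w.1.adicCompletion L)) : Matrix (Fin 2) (Fin 2) (w.1.adicCompletion L)) =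
      (u : w.1.adicCompletion L) • (1 : Matrix (Fin 2) (Fin 2) (w.1.adicCompletion L)) := by
    rw [hu, Matrix.GeneralLinearGroup.coe_scalar, Matrix.scalar_apply, Matrix.smul_one_eq_diagonal]
  have hv : Valued.v (u : w.1.adicCompletion L) = 1 :=
    F0P3cStCharTSOffStratumG.valuation_eq_one_of_map_mul_self Valued.v (galAdicCompletionMap (L := L) (IsCMField.complexConj L) hw) hσv
      (F0P3cStCharTSOffStratumG.map_mul_self_eq_one_of_scalar_mem (galAdicCompletionMap (L := L) (IsCMField.complexConj L) hw) h01 z.2 hmat)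
  rw [Subgroup.mem_comap, Subgroup.coe_subtype, mem_glInt_iff]
  have hu' : (((z : ↥(unitaryGroupOfForm _ _)) : GL (Fin 2) (w.1.adicCompletion L))⁻¹) = Matrix.GeneralLinearGroup.scalar (Fin 2) u⁻¹ := by
    rw [hu, map_inv]
  refine ⟨fun i j => ?_, fun i j => ?_⟩
  · rw [hu, Matrix.GeneralLinearGroup.coe_scalar, ← v_le_one_iff_mem_integer, Matrix.scalar_apply, Matrix.diagonal_apply]
    split_ifs
    · exact hv.le
    · rw [map_zero]; exact zero_le
  · rw [hu', Matrix.GeneralLinearGroup.coe_scalar, ← v_le_one_iff_mem_integer, Matrix.scalar_apply, Matrix.diagonal_apply]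
    split_ifs
    · rw [Units.val_inv_eq_inv_val, map_inv₀, hv, inv_one]
    · rw [map_zero]; exact zero_le

/-- **The ratio data of the ray `d(α, (σ_w α)⁻¹)`** (the inputs `s u hs hu` of an `iwahoriDatumU2`-type model datum along the ray): as `glDiagonal` of units, with the single ratio
`u₀/u₁ = α · σ_w α` of valuation `≤ |α|` (since `|σ_w α| = |α| < 1`), `|α| ≠ 0`, `|α| < 1` (in the `ValuativeRel` currency `valuation L_w`).
[cite: Casselman1995, Prop. 1.4.3] [cite: Rogawski1990, §4.4 p. 46] -/
theorem exists_units_of_coe_eq_diagonal₂ {α : w.1.adicCompletion L} (hα0 : α ≠ 0) (hα1 : Valued.v α < 1)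
    (s : ↥(unitaryGroupOfForm (galAdicCompletionMap (L := L) (IsCMField.complexConj L) hw)
      (placeForm (Matrix.of fun i j : Fin 2 => if i.val + j.val + 1 = 2 then (1 : L) else 0) w.1)))
    (hs : ((s : GL (Fin 2) (w.1.adicCompletion L)) : Matrix (Fin 2) (Fin 2) (w.1.adicCompletion L)) =
      Matrix.diagonal ![α, (galAdicCompletionMap (L := L) (IsCMField.complexConj L) hw α)⁻¹]) :
    ∃ u : Fin 2 → (w.1.adicCompletion L)ˣ, (s : GL (Fin 2) (w.1.adicCompletion L)) = glDiagonal 2 (w.1.adicCompletion L) u ∧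
      (∀ i j : Fin 2, i < j → valuation (w.1.adicCompletion L) ((u i : w.1.adicCompletion L) * ((u j : w.1.adicCompletion L))⁻¹) ≤
        valuation (w.1.adicCompletion L) α) ∧
      valuation (w.1.adicCompletion L) α ≠ 0 ∧ valuation (w.1.adicCompletion L) α < 1 := by
  have hσv : ∀ x, Valued.v ((galAdicCompletionMap (L := L) (IsCMField.complexConj L) hw) x) = Valued.v x :=
    fun x => valued_galAdicCompletionMap (L := L) (IsCMField.complexConj L) hw x
  have hσα0 : galAdicCompletionMap (L := L) (IsCMField.complexConj L) hw α ≠ 0 := by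
    intro h; apply hα0
    have := congrArg Valued.v h
    rw [hσv, map_zero] at this
    exact (Valuation.zero_iff _).1 this
  have hvα : valuation (w.1.adicCompletion L) α < 1 := (v_lt_one_iff_valuation_lt_one α).1 hα1
  have hvσα : valuation (w.1.adicCompletion L) (galAdicCompletionMap (L := L) (IsCMField.complexConj L) hw α) =
      valuation (w.1.adicCompletion L) α := (v_eq_iff_valuation_eq _ _).1 (hσv α)
  set u : Fin 2 → (w.1.adicCompletion L)ˣ :=
    ![Units.mk0 α hα0, (Units.mk0 (galAdicCompletionMap (L := L) (IsCMField.complexConj L) hw α) hσα0)⁻¹] with hu_def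
  have hu0 : ((u 0 : (w.1.adicCompletion L)ˣ) : w.1.adicCompletion L) = α := by
    simp only [hu_def, Matrix.cons_val_zero, Units.val_mk0]
  have hu1 : ((u 1 : (w.1.adicCompletion L)ˣ) : w.1.adicCompletion L) = (galAdicCompletionMap (L := L) (IsCMField.complexConj L) hw α)⁻¹ := by
    simp only [hu_def, Matrix.cons_val_one, Matrix.cons_val_zero, Units.val_inv_eq_inv_val, Units.val_mk0]
  refine ⟨u, Units.ext ?_, ?_, (Valuation.ne_zero_iff _).2 hα0, hvα⟩
  · rw [hs, coe_glDiagonal]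
    congr 1
    funext k
    fin_cases k
    · exact hu0.symm
    · exact hu1.symm
  · intro i j hij
    fin_cases i <;> fin_cases j
    all_goals first | exact absurd hij (by decide) | skip
    show valuation _ (((u 0 : (w.1.adicCompletion L)ˣ) : w.1.adicCompletion L) * (((u 1 : (w.1.adicCompletion L)ˣ) : w.1.adicCompletion L))⁻¹) ≤ _
    rw [hu0, hu1, inv_inv, map_mul, hvσα]
    calc valuation _ α * valuation _ α ≤ valuation _ α * 1 := mul_le_mul' le_rfl hvα.le
      _ = valuation _ α := mul_one _

end Summit.HodgeConjecture.HodgeConjecture.Cruxes.H413.F0P3cCMLocalNonsplitBorelTransportU2
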